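import Literature.NumberTheory.Rogawski1990.LocalNormFibreBadFrame                     -- ★ p842076 p08 (g13): the bad frame `(P′, G₁′, G₂′, hP′)` (+ ★ B3-dock, `finSum`, `twistGram`, carriers)
import Literature.NumberTheory.Rogawski1990.LocalStableClassesNonsplitScalarFrameKappa  -- ★ p841669 A-p17 (g21): `conjLocal_mul_self_of_fst_eq_smul_one` (`σ(a)·a = 1` for `ε_H.1 = a·1₂`)
import HarnessLib

/-!
# THE SECOND CLASS `ε′ := P′·(a·1₂ ⊕ᶠ u·1₁)·P′⁻¹` IN THE BAD FRAME IS UNITARY — the data binder `(ε′, hε′)` of ★ `exists_isLocallyConstant_descent_secondClass`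
# (input (i) of the `stub_N6nsS1pkg` assembly at `C′ := ↥Z(ε′)`, «N6nsGerm» ED. 1.4)

Topic `NumberTheory/Rogawski1990`; namespace `Literature.NumberTheory.Rogawski1990`.  THEOREMS ONLY (no definition, no instance, no notation, no named fact,
no `sorry`).  Cell `pub/hodgecm-mathlib` (D-0151), crux H413 = stmt-HodgeConjecture-24833, floor-2 line «N6nsGerm», stub `stub_N6nsS1` ∕ ED. 1.4's `stub_N6nsS1pkg`
(F0P2-p02 (g8) 3d036a80); A-p17 (g21) sign-off 07:47Z item (i); seat A-p16 (g26).  HONEST LABEL: HC_CM is proved only modulo the printed citations until rung 0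
closes; this file produces ONE datum of the compact-side package, nothing printed.

THE MATHEMATICS.  `P′ ∈ GL₃` with Gram matrix `ᵗ(σP′)·H′_v·P′ = G₁′ ⊕ᶠ G₂′` (★ `exists_badFrame_dock`), `ε_H = (a·1₂, u) ∈ H_v` (so `σ(a)a = 1`, `σ(u)u = 1`).  The block scalar
`D := a·1₂ ⊕ᶠ u·1₁` commutes with `G₁′ ⊕ᶠ G₂′` and is `σ`-unitary for it (`ᵗ(σD)·(G₁′ ⊕ᶠ G₂′)·D = (σ(a)a)·G₁′ ⊕ᶠ (σ(u)u)·G₂′`), hence `ε′ := P′·D·P′⁻¹` is in `U(H′)(L⁺_v)`: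
`ᵗσ(P′DP′⁻¹)·H′·(P′DP′⁻¹) = ᵗσ(P′⁻¹)·ᵗσ(D)·(ᵗσP′·H′·P′)·D·P′⁻¹ = ᵗσ(P′⁻¹)·(G₁′ ⊕ᶠ G₂′)·P′⁻¹ = H′` (★ `twistGram_mul`); and `ε′·P′ = P′·D` by construction.
[Rogawski1990 §3.1 p. 19 (`U(H) = {g : H_g = H}`), §8.2 Prop. 8.2.1 p. 112 (the second class `ε′` with compact centraliser).]

* `mem_unitaryGroup_conj_of_twistGram_eq` (generic), `conjTranspose_blockScalar_mul_finSum_mul_blockScalar` (generic), **`exists_secondClass_of_frame`** (CM).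

## References
* [Rogawski1990] J. D. Rogawski, *Automorphic Representations of Unitary Groups in Three Variables*, Ann. of Math. Stud. 123 (1990): §3.1 p. 19; §4.8 Case (a) p. 53; §8.2
  Prop. 8.2.1 p. 112.
-/

set_option autoImplicit false

noncomputable section

open NumberField IsDedekindDomain Matrix
open scoped MatrixGroups

namespace Literature.NumberTheory.Rogawski1990

open Literature.NumberTheory.Automorphic Literature.NumberTheory.Automorphic.UnitaryGroup
open Literature.AlgebraicGeometry.ShimuraVarieties (unitaryGroup)

section Generic

variable {S : Type*} [CommRing S] (σ : S →+* S) {N₁ N₂ : ℕ}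

omit σ in
/-- `(A ⊕ᶠ B)(C ⊕ᶠ D) = AC ⊕ᶠ BD`. [folklore] -/
private theorem finSum_mul_finSum₇ (A C : Matrix (Fin N₁) (Fin N₁) S) (B D : Matrix (Fin N₂) (Fin N₂) S) :
    finSum N₁ N₂ A B * finSum N₁ N₂ C D = finSum N₁ N₂ (A * C) (B * D) := by
  simp only [finSum, Matrix.reindex_apply, Matrix.submatrix_mul_equiv, Matrix.fromBlocks_multiply, Matrix.mul_zero, Matrix.zero_mul,
    add_zero, zero_add]

omit σ in
/-- `1 ⊕ᶠ 1 = 1`. [folklore] -/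
private theorem finSum_one_one₇ : finSum N₁ N₂ (1 : Matrix (Fin N₁) (Fin N₁) S) (1 : Matrix (Fin N₂) (Fin N₂) S) = 1 := by
  simp only [finSum, Matrix.fromBlocks_one, Matrix.reindex_apply, Matrix.submatrix_one_equiv]

/-- `ᵗ(σ(A ⊕ᶠ B)) = ᵗ(σA) ⊕ᶠ ᵗ(σB)`. [folklore] -/
private theorem finSum_conjTranspose₇ (A : Matrix (Fin N₁) (Fin N₁) S) (B : Matrix (Fin N₂) (Fin N₂) S) :
    ((finSum N₁ N₂ A B).map σ)ᵀ = finSum N₁ N₂ ((A.map σ)ᵀ) ((B.map σ)ᵀ) := by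
  rw [finSum_map]
  simp only [finSum, Matrix.reindex_apply, Matrix.transpose_submatrix, Matrix.fromBlocks_transpose, Matrix.transpose_zero]

/-- `ᵗ(σ(c·1)) = σ(c)·1`. [folklore] -/
private theorem conjTranspose_smul_one₇ {N : ℕ} (c : S) : (((c • (1 : Matrix (Fin N) (Fin N) S)).map σ)ᵀ) = σ c • (1 : Matrix (Fin N) (Fin N) S) := by
  rw [Matrix.smul_one_eq_diagonal, Matrix.diagonal_map (map_zero σ), Matrix.diagonal_transpose, Matrix.smul_one_eq_diagonal]

/-- **Conjugating a `K`-unitary element by a frame of Gram matrix `K` gives an `H`-unitary element**: if `ᵗ(σP)·H·P = K` and `ᵗ(σD)·K·D = K` then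
`P·D·P⁻¹ ∈ U(σ, H)`. [cite: Rogawski1990, §3.1 p. 19] -/
theorem mem_unitaryGroup_conj_of_twistGram_eq {n : Type*} [Fintype n] [DecidableEq n] (H : Matrix n n S) (P : GL n S) {K : Matrix n n S}
    (hP : twistGram σ H (P : Matrix n n S) = K) (D : GL n S) (hD : ((D : Matrix n n S).map σ)ᵀ * K * (D : Matrix n n S) = K) :
    P * D * P⁻¹ ∈ unitaryGroup σ H := by
  rw [← twistGram_coe_eq_iff_mem_unitaryGroup]
  have hPD : twistGram σ H ((P : Matrix n n S) * (D : Matrix n n S)) = twistGram σ H (P : Matrix n n S) := by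
    rw [twistGram_mul, hP, hD]
  rw [Units.val_mul, Units.val_mul, twistGram_mul, hPD, ← twistGram_mul, ← Units.val_mul, mul_inv_cancel, Units.val_one, twistGram_one]

/-- **Block scalars of `σ`-norm one are unitary for a block-diagonal Gram matrix**: `ᵗσ(a·1 ⊕ᶠ u·1)·(G₁ ⊕ᶠ G₂)·(a·1 ⊕ᶠ u·1) = G₁ ⊕ᶠ G₂` when `σ(a)a = σ(u)u = 1`.
[cite: Rogawski1990, §3.1 p. 19] -/
theorem conjTranspose_blockScalar_mul_finSum_mul_blockScalar (G₁ : Matrix (Fin N₁) (Fin N₁) S) (G₂ : Matrix (Fin N₂) (Fin N₂) S) {a u : S}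
    (ha : σ a * a = 1) (hu : σ u * u = 1) :
    ((finSum N₁ N₂ (a • (1 : Matrix (Fin N₁) (Fin N₁) S)) (u • (1 : Matrix (Fin N₂) (Fin N₂) S))).map σ)ᵀ * finSum N₁ N₂ G₁ G₂ *
        finSum N₁ N₂ (a • (1 : Matrix (Fin N₁) (Fin N₁) S)) (u • (1 : Matrix (Fin N₂) (Fin N₂) S)) = finSum N₁ N₂ G₁ G₂ := by
  have ha' : a * σ a = 1 := by rw [mul_comm]; exact ha
  have hu' : u * σ u = 1 := by rw [mul_comm]; exact hu
  rw [finSum_conjTranspose₇, conjTranspose_smul_one₇, conjTranspose_smul_one₇, finSum_mul_finSum₇, finSum_mul_finSum₇]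
  simp only [Matrix.smul_mul, Matrix.one_mul, Matrix.mul_smul, Matrix.mul_one, smul_smul, ha', hu', one_smul]

/-- The block scalar `a·1 ⊕ᶠ u·1` with `σ(a)a = σ(u)u = 1` as a unit of `GL_{N₁+N₂}` (inverse `σ(a)·1 ⊕ᶠ σ(u)·1`). [cite: Rogawski1990, §3.1 p. 19] -/
theorem exists_units_blockScalar {a u : S} (ha : σ a * a = 1) (hu : σ u * u = 1) :
    ∃ D : GL (Fin (N₁ + N₂)) S, (D : Matrix (Fin (N₁ + N₂)) (Fin (N₁ + N₂)) S) =
      finSum N₁ N₂ (a • (1 : Matrix (Fin N₁) (Fin N₁) S)) (u • (1 : Matrix (Fin N₂) (Fin N₂) S)) := by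
  have ha' : a * σ a = 1 := by rw [mul_comm]; exact ha
  have hu' : u * σ u = 1 := by rw [mul_comm]; exact hu
  refine ⟨⟨finSum N₁ N₂ (a • (1 : Matrix (Fin N₁) (Fin N₁) S)) (u • (1 : Matrix (Fin N₂) (Fin N₂) S)),
    finSum N₁ N₂ (σ a • (1 : Matrix (Fin N₁) (Fin N₁) S)) (σ u • (1 : Matrix (Fin N₂) (Fin N₂) S)), ?_, ?_⟩, rfl⟩
  · rw [finSum_mul_finSum₇, Matrix.smul_mul, Matrix.one_mul, Matrix.smul_mul, Matrix.one_mul, smul_smul, smul_smul, ha', hu', one_smul, one_smul,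
      finSum_one_one₇]
  · rw [finSum_mul_finSum₇, Matrix.smul_mul, Matrix.one_mul, Matrix.smul_mul, Matrix.one_mul, smul_smul, smul_smul, ha, hu, one_smul, one_smul,
      finSum_one_one₇]

end Generic

section CM

variable (L : Type) [Field L] [NumberField L] [IsCMField L] (H' : Matrix (Fin 3) (Fin 3) L) (v : HeightOneSpectrum (𝓞 ↥(maximalRealSubfield L)))

omit [IsCMField L] in
/-- The local form of `Φ₁ = (1)` is `(1)`. [cite: Rogawski1990, §4.8 Case (a) p. 53] -/
private theorem localFormOne_apply₇ :
    UnitaryGroup.adeleToLocal L v (UnitaryGroup.adelicForm L 1 (Matrix.of fun i j : Fin 1 => if i.val + j.val + 1 = 1 then (1 : L) else 0) 0 0) = 1 := by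
  rw [UnitaryGroup.adelicForm, Matrix.map_apply, Matrix.of_apply]
  simp

/-- **`σ(u) · u = 1`** for the entry `u` of an element of the `1 × 1` unitary group `U(Φ₁)_v`. [cite: Rogawski1990, §4.8 Case (a) p. 53] -/
private theorem conjLocal_entry_mul_entry₇ (g : (cmDatum L 1 (Matrix.of fun i j : Fin 1 => if i.val + j.val + 1 = 1 then (1 : L) else 0)).Local v) :
    UnitaryGroup.conjLocal L (IsCMField.complexConj L) v ((g.val.val : Matrix (Fin 1) (Fin 1) (LocalRing L v)) 0 0) *
      (g.val.val : Matrix (Fin 1) (Fin 1) (LocalRing L v)) 0 0 = 1 := by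
  have hmem : ((g.val.val : Matrix (Fin 1) (Fin 1) (LocalRing L v)).map (UnitaryGroup.conjLocal L (IsCMField.complexConj L) v))ᵀ *
      (UnitaryGroup.adelicForm L 1 (Matrix.of fun i j : Fin 1 => if i.val + j.val + 1 = 1 then (1 : L) else 0)).map (UnitaryGroup.adeleToLocal L v) *
      (g.val.val : Matrix (Fin 1) (Fin 1) (LocalRing L v)) =
      (UnitaryGroup.adelicForm L 1 (Matrix.of fun i j : Fin 1 => if i.val + j.val + 1 = 1 then (1 : L) else 0)).map (UnitaryGroup.adeleToLocal L v) :=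
    mem_unitaryGroupOfForm_iff.mp g.2
  have h00 := congrFun (congrFun hmem 0) 0
  simp only [Matrix.mul_apply, Fin.sum_univ_one, Matrix.transpose_apply, Matrix.map_apply, localFormOne_apply₇, mul_one] at h00
  exact h00

/-- **THE SECOND CLASS IN THE BAD FRAME.**  For `ε_H = (a·1₂, u) ∈ H_v` and a frame `P′` with `ᵗσ(P′)·H′_v·P′ = G₁′ ⊕ᶠ G₂′` there is `ε′ ∈ G′_v = U(H′)(L⁺_v)` with
`ε′·P′ = P′·(a·1₂ ⊕ᶠ u)` — the datum `(ε′, hε′)` of ★ `exists_isLocallyConstant_descent_secondClass`.  See the module docstring.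
[cite: Rogawski1990, §3.1 p. 19; §8.2 Prop. 8.2.1 p. 112] -/
theorem exists_secondClass_of_frame
    (εH : ((cmDatum L 2 (Matrix.of fun i j : Fin 2 => if i.val + j.val + 1 = 2 then (1 : L) else 0)).Local v ×
      (cmDatum L 1 (Matrix.of fun i j : Fin 1 => if i.val + j.val + 1 = 1 then (1 : L) else 0)).Local v)) (a : LocalRing L v)
    (ha : (εH.1.val.val : Matrix (Fin 2) (Fin 2) (LocalRing L v)) = a • (1 : Matrix (Fin 2) (Fin 2) (LocalRing L v)))
    {P' : GL (Fin (2 + 1)) (LocalRing L v)} {G₁' : Matrix (Fin 2) (Fin 2) (LocalRing L v)} {G₂' : Matrix (Fin 1) (Fin 1) (LocalRing L v)}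
    (hP' : twistGram (conjLocal L (IsCMField.complexConj L) v) ((adelicForm L 3 H').map (adeleToLocal L v)) P'.val = finSum 2 1 G₁' G₂') :
    ∃ ε' : (cmDatum L 3 H').Local v,
      (ε'.val.val : Matrix (Fin 3) (Fin 3) (LocalRing L v)) * P'.val =
        P'.val * finSum 2 1 (a • (1 : Matrix (Fin 2) (Fin 2) (LocalRing L v))) (εH.2.val.val : Matrix (Fin 1) (Fin 1) (LocalRing L v)) := by
  set u : LocalRing L v := (εH.2.val.val : Matrix (Fin 1) (Fin 1) (LocalRing L v)) 0 0 with hudef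
  have hD₂ : (εH.2.val.val : Matrix (Fin 1) (Fin 1) (LocalRing L v)) = u • (1 : Matrix (Fin 1) (Fin 1) (LocalRing L v)) := by
    ext i j
    have hi : i = 0 := Subsingleton.elim _ _
    have hj : j = 0 := Subsingleton.elim _ _
    subst hi; subst hj
    rw [Matrix.smul_apply, Matrix.one_apply_eq, smul_eq_mul, mul_one]
  have hau : UnitaryGroup.conjLocal L (IsCMField.complexConj L) v a * a = 1 := conjLocal_mul_self_of_fst_eq_smul_one (L := L) (v := v) (a := εH) ha
  have huu : UnitaryGroup.conjLocal L (IsCMField.complexConj L) v u * u = 1 := conjLocal_entry_mul_entry₇ L v εH.2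
  obtain ⟨D, hD⟩ := exists_units_blockScalar (conjLocal L (IsCMField.complexConj L) v) (N₁ := 2) (N₂ := 1) hau huu
  have hDK : ((D : Matrix (Fin (2 + 1)) (Fin (2 + 1)) (LocalRing L v)).map (conjLocal L (IsCMField.complexConj L) v))ᵀ * finSum 2 1 G₁' G₂' *
      (D : Matrix (Fin (2 + 1)) (Fin (2 + 1)) (LocalRing L v)) = finSum 2 1 G₁' G₂' := by
    rw [hD]
    exact conjTranspose_blockScalar_mul_finSum_mul_blockScalar (conjLocal L (IsCMField.complexConj L) v) G₁' G₂' hau huu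
  have hmem := mem_unitaryGroup_conj_of_twistGram_eq (conjLocal L (IsCMField.complexConj L) v) ((adelicForm L 3 H').map (adeleToLocal L v)) P' hP' D hDK
  refine ⟨⟨P' * D * P'⁻¹, hmem⟩, ?_⟩
  have hPP : (P'⁻¹).val * P'.val = 1 := by rw [← Units.val_mul, inv_mul_cancel, Units.val_one]
  show (P' * D * P'⁻¹).val * P'.val = P'.val * _
  rw [hD₂, ← hD, Units.val_mul, Units.val_mul, Matrix.mul_assoc, hPP, Matrix.mul_one]

end CM

end Literature.NumberTheory.Rogawski1990
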